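import Summits.BirchSwinnertonDyer.BirchSwinnertonDyer.Theorems.BiquadraticEisensteinDescentManinDatumSupercuspidalCMInertOfSexticDictionaryMulCharRho
import Literature.NumberTheory.EllipticCurves.SexticTwistThetaDictionaryInert
import Literature.NumberTheory.EllipticCurves.NewformGaloisRepIntegralityProofs
import HarnessLib

set_option linter.dupNamespace false -- `Summit.BirchSwinnertonDyer.BirchSwinnertonDyer.Theorems.…` (summit = sub, D-0017)
set_option autoImplicit false

/-!
# Crux `ManinDatumSupercuspidalCMInert` (stmt-BirchSwinnertonDyer-20111, BED r605), stub `stub_S5` — PACKAGING the landed sextic theta dictionary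
# (`SexticTwist.lSeries_twist_eq_thetaLFunction_five`, bed-w2 g11) into the per-`(k, ℓ, χ)` data of this seat's `hdictAllRho`
# (width seat `bsd-wall-cm-bed-w3` g11; theorems only; route cone; `--supports 20111`, helper)

Route `BiquadraticEisensteinDescent` (cell `pub/bsd-wall`). The E-side export `Literature/…/SexticTwistThetaDictionaryInert.lSeries_twist_eq_thetaLFunction_five`
(Ireland–Rosen Ch. 18 §7 for `E^k : y² = x³ + k` over `ℤ[ζ]`, the `5`-part of the weight split off as `Φ₅ = embC((·/5)₆)^e` at the inert prime `5`)
delivers, for `k ≠ 0` sixth-power-free with `5 ∣ k` OUTSIDE the good-at-`2` class `k = 16u`, `u ≡ 1 (4)`, and a modulus `m` prime to `5` with any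
weight `c : ℤ/m → ℂ`: `e, k₁, M′ = 36|k₁|m, Φ₅, Ψ` with `LSeries(c·a_n(E^k))(s) = (4^s/2)·Θ-L_{3,2·5M′}((Φ₅ ⊗ Ψ)♯)(s)` (`re s > 3/2`). This file reads
it in the currency of `…OfSexticDictionaryMulCharRho.hdictAllRho` at `c = χ̄`:

* ★ `dictDataRho_of_not_goodAtTwo` — for `k ≠ 0`, `5 ∣ k`, sixth-power-free, `¬ (k = 16u, u ≡ 1 (4))`, a prime `ℓ ∤ k` and a character `χ` mod `ℓ`:
  the `∃ (e k₁ M′ : ℕ) (_ : NeZero M′) Φ₅ Ψ W L u N, …` body of `hdictAllRho` (`W := Φ₅ ⊗ Ψ`, `L(s) := (4^s/2)·Θ(s)` entire, `u = 2`, `N = 1`,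
  `k₁ ↦ |k₁|`; `5 ∤ ℓ` because `ℓ` is a prime not dividing `k ∋ 5`; `χ̄` has algebraic-integer values).

What remains for `hdictAllRho` (hence for the crux, `maninDatumSupercuspidalCMInert_of_sexticDictionary_mulCharRho`): the same data on the good-at-`2`
class `k = 16u`, `u ≡ 1 (4)` (bed-w2 g11, announced). HONEST FRAMING: nothing here proves the stub, the crux, Manin's conjecture or BSD. No definition,
no named fact, no `sorry`; axioms standard.
-/

noncomputable section

open scoped Classical
open Complex
open Literature.NumberTheory.EllipticCurves
open Literature.NumberTheory.LFunctions

namespace Summit.BirchSwinnertonDyer.BirchSwinnertonDyer.Theorems.BiquadraticEisensteinDescentManinDatumSupercuspidalCMInertSexticDictionaryPackaging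

/-- `√3` cast from `ℕ` or as a numeral. [folklore] -/
theorem sqrt_three_natCast : (Real.sqrt (3 : ℕ) : ℂ) = (Real.sqrt 3 : ℂ) := by norm_num

/-- `ℓ` prime, `ℓ ∤ k`, `5 ∣ k` ⇒ `5 ∤ ℓ`. [folklore] -/
theorem not_five_dvd_of_prime_not_dvd {k : ℤ} {ℓ : ℕ} (hℓ : ℓ.Prime) (hℓk : ¬ (ℓ : ℤ) ∣ k) (h5k : (5 : ℤ) ∣ k) : ¬ 5 ∣ ℓ := by
  intro h
  have h5 : ℓ = 5 := ((Nat.prime_dvd_prime_iff_eq (by norm_num) hℓ).mp h).symm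
  subst h5
  exact hℓk h5k

/-- `|k| = 5^e·|k₁|` for `k = 5^e·k₁`. [folklore] -/
theorem natAbs_eq_of_eq_pow_mul {k k₁ : ℤ} {e : ℕ} (h : k = 5 ^ e * k₁) : k.natAbs = 5 ^ e * k₁.natAbs := by
  rw [h, Int.natAbs_mul, Int.natAbs_pow]
  rfl

/-- `s ↦ (4^s/2)·Θ(s)` is entire. [folklore] -/
theorem differentiable_cpow_div_mul {Θ : ℂ → ℂ} (hΘ : Differentiable ℂ Θ) :
    Differentiable ℂ (fun s : ℂ ↦ (4 : ℂ) ^ s / 2 * Θ s) :=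
  ((differentiable_id.const_cpow (Or.inl (by norm_num : (4 : ℂ) ≠ 0))).div_const 2).mul hΘ

/-- ★ **The per-`(k, ℓ, χ)` dictionary data of `hdictAllRho` outside the good-at-`2` class**, from bed-w2 g11's
`SexticTwist.lSeries_twist_eq_thetaLFunction_five` at `c = χ̄`: `W = Φ₅ ⊗ Ψ`, `L(s) = (4^s/2)·Θ-L_{3,2·5M′}(W♯)(s)`, `u = 2`, `N = 1`.
[cite: IrelandRosen1990, Ch. 18 §7] [cite: Rubin1999, §7.4 Prop. 7.15] -/
theorem dictDataRho_of_not_goodAtTwo (k : ℤ) (hk : k ≠ 0) (h5k : (5 : ℤ) ∣ k) (h6 : ∀ q : ℕ, q.Prime → ¬ ((q : ℤ) ^ 6 ∣ k))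
    (h2 : ¬ ∃ u : ℤ, u % 4 = 1 ∧ k = 16 * u)
    (ℓ : ℕ) [NeZero ℓ] (hℓ : ℓ.Prime) (hℓk : ¬ (ℓ : ℤ) ∣ k) (χ : DirichletCharacter ℂ ℓ) :
    ∃ (e k₁ M' : ℕ) (_ : NeZero M') (Φ₅ : ZMod 5 × ZMod 5 → ℂ) (Ψ W : ℤ × ℤ → ℂ) (L : ℂ → ℂ) (u : ℂ) (N : ℕ),
      1 ≤ e ∧ e ≤ 5 ∧ k.natAbs = 5 ^ e * k₁ ∧ Nat.Coprime 5 M' ∧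
      Φ₅ 0 = 0 ∧
      (∀ d d' : ZMod 5 × ZMod 5, Φ₅ (d.1 * d'.2 + d.2 * d'.1 - d.1 * d'.1, d.2 * d'.2 - d.1 * d'.1) = Φ₅ d * Φ₅ d') ∧
      Φ₅ (-1, 1) = (-(UpperHalfPlane.ρ : ℂ) ^ 2) ^ e ∧
      (∀ y z : ℤ × ℤ, Ψ (y.1 + M' * z.1, y.2 + M' * z.2) = Ψ y) ∧ (∀ y : ℤ × ℤ, IsIntegral ℤ (Ψ y)) ∧
      (∀ y : ℤ × ℤ, W y = Φ₅ ((y.2 : ZMod 5), ((y.1 + y.2 : ℤ) : ZMod 5)) * Ψ y) ∧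
      Differentiable ℂ L ∧
      (∀ s : ℂ, 2 < s.re →
        L s = LSeries (fun n : ℕ ↦ χ⁻¹ (n : ZMod ℓ) * ((⟨0, 0, 0, 0, (k : ℚ)⟩ : WeierstrassCurve ℚ).LFunction n : ℂ)) s) ∧
      IsIntegral ℤ u ∧ ¬ 5 ∣ N ∧
      L 1 = u / N * BinaryTheta.thetaLFunction 3 (2 * (5 * M')) 1 (-((Real.sqrt (3 : ℕ) : ℂ) * I))
        (QuadOrder.parityLift W) 1 := by
  have h5ℓ : ¬ 5 ∣ ℓ := not_five_dvd_of_prime_not_dvd hℓ hℓk h5k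
  have hc : ∀ a : ZMod ℓ, IsIntegral ℤ ((fun a : ZMod ℓ ↦ χ⁻¹ a) a) := fun a ↦
    ModularForms.isIntegral_dirichletCharacter_apply χ⁻¹ a
  obtain ⟨e, k₁, M', hM', _, Φ₅, Ψ, he1, he5, hke, -, -, hcop, hΦ0, hmul, hgen, -, hΨper, hΨint, -, hdict⟩ :=
    SexticTwist.lSeries_twist_eq_thetaLFunction_five hk h6 h2 h5k h5ℓ (fun a : ZMod ℓ ↦ χ⁻¹ a)
  refine ⟨e, k₁.natAbs, M', hM', Φ₅, Ψ, fun y ↦ Φ₅ ((y.2 : ZMod 5), ((y.1 + y.2 : ℤ) : ZMod 5)) * Ψ y,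
    fun s ↦ (4 : ℂ) ^ s / 2 * BinaryTheta.thetaLFunction 3 (2 * (5 * M')) 1 (-((Real.sqrt (3 : ℕ) : ℂ) * I))
      (QuadOrder.parityLift fun y : ℤ × ℤ ↦ Φ₅ ((y.2 : ZMod 5), ((y.1 + y.2 : ℤ) : ZMod 5)) * Ψ y) s,
    2, 1, he1, he5, natAbs_eq_of_eq_pow_mul hke, hcop, hΦ0, hmul, hgen, hΨper, hΨint hc, fun _ ↦ rfl,
    differentiable_cpow_div_mul (BinaryTheta.differentiable_thetaLFunction 3 (2 * (5 * M')) 1 _ _), fun s hs ↦ ?_,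
    by simpa using isIntegral_algebraMap (R := ℤ) (A := ℂ) (x := (2 : ℤ)), by decide, ?_⟩
  · -- agreement with the twisted `L`-series on `re s > 2`
    have h := hdict s (by linarith)
    simp only
    rw [sqrt_three_natCast, ← h]
    rfl
  · simp only
    rw [Complex.cpow_one, Nat.cast_one, div_one]
    norm_num

end Summit.BirchSwinnertonDyer.BirchSwinnertonDyer.Theorems.BiquadraticEisensteinDescentManinDatumSupercuspidalCMInertSexticDictionaryPackaging

end
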